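import Literature.Probability.Percolation.TriangularBoxCrossing
import Literature.Probability.Percolation.Isoradial
import Literature.Probability.LatticeModels.TriangularLatticeProofs
import Literature.Probability.LatticeModels.IsoradialPercolationProofs
import HarnessLib

/-!
# The box-crossing property of critical bond percolation on `𝕋` (Grimmett–Manolescu 2013): proofs around the fact

Topic `Literature/Probability/Percolation`. Companion (theorems only) of
`Literature.Probability.Percolation.TriangularBoxCrossing`, which vendors the homogeneous
triangular case of G. R. Grimmett, I. Manolescu, *Inhomogeneous bond percolation on square,
triangular and hexagonal lattices*, Ann. Probab. **41** (2013) 2990–3025 = arXiv:1105.5535, §1.3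
main Theorem (b) [GrimmettManolescuAOP2013] as the named fact
`GrimmettManolescuAOP2013_triangular_boxCrossing`: critical bond percolation
`bondPercolation triGraph (criticalWeightI (π/6))` has the (two-sided, axis-parallel, H21-rendered)
box-crossing property `HasBoxCrossingProperty` in every drawing `s • triEmbed`, `0 < s ≤ 2`.

## Contents (all proved)

* `HasBoxCrossingProperty.smul_of_smul` — for a finite measure carried by `{ω ⊆ E(G)}` and a
  drawing `z` of `G` with edges of length `≤ 1`, the rendered box-crossing property passes from
  `t • z` to `s • z` for all `s, t ∈ (0, 2]` (walk surgery `embRectCrossing_smul_of_smul`,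
  `embTBCrossing_smul_of_smul`: last visit to the entrance side, first subsequent visit to the
  exit side; the slack `2` of the rendering absorbs one edge);
* `GrimmettManolescuAOP2013_triangular_boxCrossing_of_scale` — the fact follows from the
  box-crossing property of one drawing `t • triEmbed`, `0 < t ≤ 2`;
* `GrimmettManolescuAOP2013_triangular_boxCrossing_iff_route_normalisation` — the fact is
  equivalent to the body of the route item it grounds (drawing `√3 (triEmbed − (1 + ζ)/3)`);
* `GrimmettManolescuAOP2013_triangular_boxCrossing_of_isoradialEmbedding` — the fact follows
  from the conclusion of the tree fact `gm_boxCrossing` (Grimmett–Manolescu 2014, Thm 1.1(a))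
  for any rhombic embedding of `triGraph` drawn as `t • triEmbed − w₀`, `0 < t ≤ 2`, whose
  canonical measure is `bondPercolation triGraph (criticalWeightI (π/6))`;
* `triGraph_preconnected`, `GrimmettManolescuAOP2013_triangular_boxCrossing_of_gm_boxCrossing` —
  the same with the hypotheses of `gm_boxCrossing triGraph emb ε` spelled out (`𝕋 ∈ 𝒢`:
  isoradial, rhombic tiling, BAP(`ε`), printed square-grid property): exactly what separates the
  fact from the catalogued isoradial theorem.

What is NOT here: the theorem itself (box crossings at one scale), i.e. the star–triangle
transport of GM2013 §§2–3 / GM2014 §§5–7; see the status paragraph of the fact's docstring.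

## References

* G. R. Grimmett, I. Manolescu, Ann. Probab. 41 (2013) 2990–3025, arXiv:1105.5535: §1.3
  (Definition of the box-crossing property, "invariant under affine maps"; main Theorem (b)),
  §3.1 (Proposition (RSW) and the Remark after it; arXiv flat numbering Prop. 12, Remark 13),
  §3.3 (proofs of the two transport Propositions, arXiv Props. 15–16: truncation of transported
  open paths to crossings of boxes).
* G. R. Grimmett, I. Manolescu, PTRF 159 (2014) 273–327, arXiv:1204.0505, Thm 1.1(a) / §3
  Thm 3.1 (the tree fact `gm_boxCrossing`).
-/

noncomputable section

namespace Literature.Probability.Percolation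

open Literature.Probability.LatticeModels

/-! ### The fact does not depend on the scale `s ∈ (0, 2]` of the drawing

The source's box-crossing property is scale-free ("invariant under affine maps of `ℝ²`",
§1.3), whereas the tree's rendering `HasBoxCrossingProperty μ z` is tied to a drawing `z` through
the slack `2` of `embRectCrossing`/`embTBCrossing`. We prove here, once and for all, that for a
graph drawn with edges of length `≤ 1` by `z`, the rendered property passes between the homothetic
drawings `t • z` and `s • z` for all `s, t ∈ (0, 2]` (`HasBoxCrossingProperty.smul_of_smul`): a
rendered crossing of a box by one drawing is read, after the homothety, as an open walk between
the two sides of the corresponding box of the other drawing, and the sub-walk from its *last*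
visit to the entrance side to its *first* subsequent visit to the exit side is a rendered crossing
there, the overshoot at either end being one edge, of length `≤ 2 =` slack
(`embRectCrossing_smul_of_smul`, `embTBCrossing_smul_of_smul`); the integrality of the scale in
`BoxCrossingBounds` is absorbed by `⌊·⌋₊`/`⌈·⌉₊` and a change of aspect ratio (`2ρ` for the lower
bounds, `ρ/2` for the upper bounds). Consequently the fact
`GrimmettManolescuAOP2013_triangular_boxCrossing` is equivalent to the box-crossing property of
any single drawing `t • triEmbed`, `0 < t ≤ 2` (`…_of_scale`), in particular to the body of the
route item it grounds (`…_iff_route_normalisation`, edge length `√3`), and it follows from the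
conclusion of the tree fact `gm_boxCrossing` (Grimmett–Manolescu 2014, Thm 1.1(a)) for any
isoradial rhombic embedding of `triGraph` drawn as a homothetic translate of `triEmbed` whose
canonical measure is `bondPercolation triGraph (criticalWeightI (π/6))`
(`…_of_isoradialEmbedding`; the unit-circumradius isoradial drawing has edge length `√3 ≤ 2`).
These are the formalisation-internal steps of GM2013, §3.1 (Proposition (RSW) and the Remark after
it — arXiv:1105.5535 flat numbering Prop. 12, Remark 13: the box-crossing property is a statement
about axis-parallel boxes at all large scales, uniformly in translations) needed to read the printed, scale-free theorem in the tree's rendering; the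
theorem itself (the star–triangle transport of §§2–3) is not proved here. -/

section ScaleTransfer

open MeasureTheory ProbabilityTheory

variable {V : Type*}

/-- **Last visit.** If some vertex of a walk satisfies `P`, the walk has a suffix starting at a
vertex satisfying `P` none of whose later vertices satisfies `P`. [folklore] -/
private theorem exists_lastVisit {H : SimpleGraph V} (P : V → Prop) :
    ∀ {x y : V} (W : H.Walk x y), (∃ t ∈ W.support, P t) →
      ∃ (u : V) (W₁ : H.Walk u y), P u ∧ (∀ t ∈ W₁.support, t ∈ W.support) ∧
        ∀ t ∈ W₁.support.tail, ¬ P t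
  | x, _, .nil, h => by
      obtain ⟨t, ht, hPt⟩ := h
      rw [SimpleGraph.Walk.support_nil, List.mem_singleton] at ht
      subst ht
      exact ⟨_, .nil, hPt, fun t ht => ht, by simp⟩
  | x, y, .cons (v := x') hadj W', h => by
      by_cases hex : ∃ t ∈ W'.support, P t
      · obtain ⟨u, W₁, hu, hsub, htail⟩ := exists_lastVisit P W' hex
        refine ⟨u, W₁, hu, fun t ht => ?_, htail⟩
        rw [SimpleGraph.Walk.support_cons]
        exact List.mem_cons_of_mem _ (hsub t ht)
      · push Not at hex
        obtain ⟨t, ht, hPt⟩ := h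
        rw [SimpleGraph.Walk.support_cons, List.mem_cons] at ht
        rcases ht with rfl | ht
        · refine ⟨_, .cons hadj W', hPt, fun t ht => ht, fun t ht => ?_⟩
          rw [SimpleGraph.Walk.support_cons, List.tail_cons] at ht
          exact hex t ht
        · exact absurd hPt (hex t ht)

/-- **First exit.** A walk from a vertex where `P` fails to one where `P` holds has a prefix on
which `P` fails, followed by one edge into a vertex satisfying `P`. [folklore] -/
private theorem exists_firstExit' {H : SimpleGraph V} (P : V → Prop) :
    ∀ {u v : V} (W : H.Walk u v), ¬ P u → P v →
      ∃ (a b : V) (q : H.Walk u a), H.Adj a b ∧ P b ∧ (∀ t ∈ q.support, ¬ P t) ∧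
        (∀ t ∈ q.support, t ∈ W.support) ∧ b ∈ W.support
  | _, _, .nil, hu, hv => (hu hv).elim
  | u, _, .cons (v := x) h W', hu, hv => by
    by_cases hx : P x
    · exact ⟨u, x, .nil, h, hx, by simpa using hu, by simp, by simp⟩
    · obtain ⟨a, b, q, hab, hb, hq, hsup, hbmem⟩ := exists_firstExit' P W' hx hv
      refine ⟨a, b, .cons h q, hab, hb, ?_, ?_, ?_⟩
      · intro t ht
        rw [SimpleGraph.Walk.support_cons, List.mem_cons] at ht
        rcases ht with rfl | ht
        · exact hu
        · exact hq t ht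
      · intro t ht
        rw [SimpleGraph.Walk.support_cons, List.mem_cons] at ht ⊢
        rcases ht with rfl | ht
        · exact Or.inl rfl
        · exact Or.inr (hsup t ht)
      · rw [SimpleGraph.Walk.support_cons, List.mem_cons]
        exact Or.inr hbmem

/-- **Sub-walk between two levels.** Let `f` change by at most `ℓ ≥ 0` along every edge of `H`.
A walk from `{f ≤ r₁}` to `{r₂ ≤ f}`, `r₁ ≤ r₂`, contains a walk (through vertices of the original
one) from `{f ≤ r₁}` to `{r₂ ≤ f}` all of whose vertices satisfy `r₁ - ℓ ≤ f ≤ r₂ + ℓ`: go to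
the last visit to `{f ≤ r₁}`, then stop at the first subsequent visit to `{r₂ ≤ f}`. (The
standard truncation of open crossings, e.g. Grimmett 1999, §11.3; GM2013 §3.3, "we deduce that
`Γ(N)` contains an open path `Γ'` that crosses `B_{(α-1)N,2N}`".) [folklore] -/
private theorem exists_subwalk_between {H : SimpleGraph V} (f : V → ℝ) {ℓ : ℝ} (hℓ : 0 ≤ ℓ)
    (hf : ∀ ⦃u v : V⦄, H.Adj u v → |f u - f v| ≤ ℓ) {x y : V} (W : H.Walk x y) {r₁ r₂ : ℝ}
    (h12 : r₁ ≤ r₂) (hx : f x ≤ r₁) (hy : r₂ ≤ f y) :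
    ∃ (u v : V) (W' : H.Walk u v), f u ≤ r₁ ∧ r₂ ≤ f v ∧
      (∀ t ∈ W'.support, t ∈ W.support) ∧ ∀ t ∈ W'.support, r₁ - ℓ ≤ f t ∧ f t ≤ r₂ + ℓ := by
  obtain ⟨u, W₁, hu, hsub, htail⟩ :=
    exists_lastVisit (fun t => f t ≤ r₁) W ⟨x, W.start_mem_support, hx⟩
  -- every vertex of the suffix `W₁` has `r₁ - ℓ ≤ f`
  have hlow : ∀ t ∈ W₁.support, r₁ - ℓ ≤ f t := by
    intro t ht
    cases W₁ with
    | nil =>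
      rw [SimpleGraph.Walk.support_nil, List.mem_singleton] at ht
      subst ht
      linarith
    | cons hadj W₂ =>
      rw [SimpleGraph.Walk.support_cons] at ht htail
      rw [List.tail_cons] at htail
      rcases List.mem_cons.1 ht with rfl | ht
      · have h1 : ¬ f _ ≤ r₁ := htail _ W₂.start_mem_support
        have h2 := hf hadj
        rw [abs_le] at h2
        push Not at h1
        linarith
      · have h1 : ¬ f t ≤ r₁ := htail t ht
        push Not at h1
        linarith
  by_cases huy : r₂ ≤ f u
  · refine ⟨u, u, SimpleGraph.Walk.nil, hu, huy, ?_, ?_⟩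
    · intro t ht
      rw [SimpleGraph.Walk.support_nil, List.mem_singleton] at ht
      subst ht
      exact hsub _ W₁.start_mem_support
    · intro t ht
      rw [SimpleGraph.Walk.support_nil, List.mem_singleton] at ht
      subst ht
      exact ⟨hlow _ W₁.start_mem_support, by linarith⟩
  · obtain ⟨a, b, q, hab, hb, hq, hqsub, hbmem⟩ :=
      exists_firstExit' (fun t => r₂ ≤ f t) W₁ huy hy
    refine ⟨u, b, q.concat hab, hu, hb, ?_, ?_⟩
    · intro t ht
      rw [SimpleGraph.Walk.support_concat, List.mem_append, List.mem_singleton] at ht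
      rcases ht with ht | rfl
      · exact hsub t (hqsub t ht)
      · exact hsub _ hbmem
    · intro t ht
      rw [SimpleGraph.Walk.support_concat, List.mem_append, List.mem_singleton] at ht
      rcases ht with ht | rfl
      · have h1 : ¬ r₂ ≤ f t := hq t ht
        push Not at h1
        exact ⟨hlow t (hqsub t ht), by linarith⟩
      · have h1 : ¬ r₂ ≤ f a := hq a q.end_mem_support
        have h2 := hf hab
        rw [abs_le] at h2
        push Not at h1
        exact ⟨hlow _ hbmem, by linarith⟩

variable {G : SimpleGraph V}

/-- Along an open edge of a configuration carried by `E(G)`, a drawing with edges of length `≤ 1`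
moves by at most `1`; hence the coordinate `s • re z` moves by at most `s`. [folklore] -/
private theorem abs_sub_le_of_openGraph_adj {z : V → ℂ}
    (hz : ∀ ⦃u v : V⦄, G.Adj u v → ‖z u - z v‖ ≤ 1) {ω : BondConfig V} (hω : ω ⊆ G.edgeSet)
    {s : ℝ} (hs : 0 < s) (c : ℝ) {u v : V} (huv : (openGraph ω).Adj u v) :
    |(s * (z u).re - c) - (s * (z v).re - c)| ≤ s ∧
      |(s * (z u).im - c) - (s * (z v).im - c)| ≤ s := by
  rw [openGraph_adj] at huv
  have h1 : ‖z u - z v‖ ≤ 1 := hz ((SimpleGraph.mem_edgeSet G).1 (hω huv.1))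
  have h2 : |(z u - z v).re| ≤ ‖z u - z v‖ := Complex.abs_re_le_norm _
  have h3 : |(z u - z v).im| ≤ ‖z u - z v‖ := Complex.abs_im_le_norm _
  rw [Complex.sub_re] at h2
  rw [Complex.sub_im] at h3
  have e1 : (s * (z u).re - c) - (s * (z v).re - c) = s * ((z u).re - (z v).re) := by ring
  have e2 : (s * (z u).im - c) - (s * (z v).im - c) = s * ((z u).im - (z v).im) := by ring
  rw [e1, e2, abs_mul, abs_mul, abs_of_pos hs]
  constructor
  · calc s * |(z u).re - (z v).re| ≤ s * 1 := mul_le_mul_of_nonneg_left (h2.trans h1) hs.le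
      _ = s := mul_one s
  · calc s * |(z u).im - (z v).im| ≤ s * 1 := mul_le_mul_of_nonneg_left (h3.trans h1) hs.le
      _ = s := mul_one s

/-- Walk formulation of the vertical crossing event (as `mem_embRectCrossing_iff` for the
horizontal one). [folklore] -/
private theorem mem_embTBCrossing_iff_walk {z : V → ℂ} {a b : ℝ} {ω : BondConfig V} :
    ω ∈ embTBCrossing z a b ↔ ∃ (x y : V) (W : (openGraph ω).Walk x y),
      (z x).im ≤ 0 ∧ b ≤ (z y).im ∧
      ∀ v ∈ W.support, (z v).re ∈ Set.Icc 0 a ∧ (z v).im ∈ Set.Icc (-2) (b + 2) := by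
  simp only [embTBCrossing, mem_openCrossing_iff, Set.mem_setOf_eq,
    mem_openConnIn_iff_exists_openWalk]
  constructor
  · rintro ⟨x, hx, y, hy, W, hW⟩
    exact ⟨x, y, W, hx, hy, hW⟩
  · rintro ⟨x, y, W, hx, hy, hW⟩
    exact ⟨x, hx, y, hy, W, hW⟩

/-- **A rendered horizontal crossing read in a homothetic drawing.** Let `G` be drawn by `z` with
edges of length `≤ 1`, let `ω ⊆ E(G)`, `0 < s ≤ 2`, `0 < t`, and let the translations correspond
under the homothety, `s w' = t w`. If `ω` crosses horizontally the box `w' + [0, a'] × [0, b']` of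
the drawing `t • z` (rendered event, slack `2`), and that box is, after the homothety of ratio
`s/t`, at least as long and at most as tall as `w + [0, a] × [0, b]` (`t a ≤ s a'`, `s b' ≤ t b`,
`0 ≤ a`), then `ω` crosses horizontally the box `w + [0, a] × [0, b]` of the drawing `s • z`: the
sub-walk of the given open walk from its last visit to `{re ≤ 0}` to its first subsequent visit to
`{a ≤ re}` (coordinates of `s • z - w`) overshoots either side by at most one edge, of length
`s ≤ 2`. (GM2013 §3.1, Proposition (RSW) / the Remark after it, and §3.3 — arXiv flat numbering Prop. 12,
Remark 13, proof of Prop. 15: crossings of longer, flatter boxes contain crossings; H21 rendering.) [cite: GrimmettManolescuAOP2013, §3.1 Proposition (RSW) with the Remark after it, §3.3 proof of the horizontal Proposition (arXiv:1105.5535 flat numbering: Prop. 12, Remark 13, Prop. 15)] -/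
theorem embRectCrossing_smul_of_smul {z : V → ℂ}
    (hz : ∀ ⦃u v : V⦄, G.Adj u v → ‖z u - z v‖ ≤ 1) {ω : BondConfig V} (hω : ω ⊆ G.edgeSet)
    {s t : ℝ} (hs : 0 < s) (hs2 : s ≤ 2) (ht : 0 < t) {w w' : ℂ} (hw : (s : ℂ) * w' = (t : ℂ) * w)
    {a b a' b' : ℝ} (ha : 0 ≤ a) (haa' : t * a ≤ s * a') (hbb' : s * b' ≤ t * b)
    (h : ω ∈ embRectCrossing (fun v => (t : ℂ) * z v - w') a' b') :
    ω ∈ embRectCrossing (fun v => (s : ℂ) * z v - w) a b := by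
  rw [mem_embRectCrossing_iff_holds] at h ⊢
  obtain ⟨x, y, W, hx, hy, hW⟩ := h
  simp only [Complex.sub_re, Complex.sub_im, Complex.re_ofReal_mul, Complex.im_ofReal_mul]
    at hx hy hW ⊢
  have hwre : s * w'.re = t * w.re := by simpa using congrArg Complex.re hw
  have hwim : s * w'.im = t * w.im := by simpa using congrArg Complex.im hw
  -- the coordinates of the two drawings are proportional
  have ere : ∀ v, s * (t * (z v).re - w'.re) = t * (s * (z v).re - w.re) := fun v => by
    linear_combination -(hwre)
  have eim : ∀ v, s * (t * (z v).im - w'.im) = t * (s * (z v).im - w.im) := fun v => by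
    linear_combination -(hwim)
  have hx' : s * (z x).re - w.re ≤ 0 := by
    have := ere x
    nlinarith
  have hy' : a ≤ s * (z y).re - w.re := by
    have := ere y
    nlinarith
  obtain ⟨u, v, W', hu, hv, hsub, hbd⟩ := exists_subwalk_between
    (H := openGraph ω) (fun v => s * (z v).re - w.re) hs.le
    (fun u v huv => (abs_sub_le_of_openGraph_adj hz hω hs w.re huv).1) W ha hx' hy'
  refine ⟨u, v, W', hu, hv, fun q hq => ?_⟩
  obtain ⟨h1, h2⟩ := hbd q hq
  obtain ⟨-, h3, h4⟩ := hW q (hsub q hq)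
  have h5 := eim q
  refine ⟨⟨by linarith, by linarith⟩, ?_, ?_⟩
  · nlinarith
  · nlinarith

/-- **A rendered vertical crossing read in a homothetic drawing** (as
`embRectCrossing_smul_of_smul`, with the roles of the coordinates exchanged): here the box of the
drawing `t • z` must be at least as tall and at most as wide (`t b ≤ s b'`, `s a' ≤ t a`, `0 ≤ b`).
[cite: GrimmettManolescuAOP2013, §3.1 Proposition (RSW) with the Remark after it, §3.3 (arXiv:1105.5535 flat numbering: Prop. 12, Remark 13, Prop. 16)] -/
theorem embTBCrossing_smul_of_smul {z : V → ℂ}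
    (hz : ∀ ⦃u v : V⦄, G.Adj u v → ‖z u - z v‖ ≤ 1) {ω : BondConfig V} (hω : ω ⊆ G.edgeSet)
    {s t : ℝ} (hs : 0 < s) (hs2 : s ≤ 2) (ht : 0 < t) {w w' : ℂ} (hw : (s : ℂ) * w' = (t : ℂ) * w)
    {a b a' b' : ℝ} (hb : 0 ≤ b) (hbb' : t * b ≤ s * b') (haa' : s * a' ≤ t * a)
    (h : ω ∈ embTBCrossing (fun v => (t : ℂ) * z v - w') a' b') :
    ω ∈ embTBCrossing (fun v => (s : ℂ) * z v - w) a b := by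
  rw [mem_embTBCrossing_iff_walk] at h ⊢
  obtain ⟨x, y, W, hx, hy, hW⟩ := h
  simp only [Complex.sub_re, Complex.sub_im, Complex.re_ofReal_mul, Complex.im_ofReal_mul]
    at hx hy hW ⊢
  have hwre : s * w'.re = t * w.re := by simpa using congrArg Complex.re hw
  have hwim : s * w'.im = t * w.im := by simpa using congrArg Complex.im hw
  have ere : ∀ v, s * (t * (z v).re - w'.re) = t * (s * (z v).re - w.re) := fun v => by
    linear_combination -(hwre)
  have eim : ∀ v, s * (t * (z v).im - w'.im) = t * (s * (z v).im - w.im) := fun v => by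
    linear_combination -(hwim)
  have hx' : s * (z x).im - w.im ≤ 0 := by
    have := eim x
    nlinarith
  have hy' : b ≤ s * (z y).im - w.im := by
    have := eim y
    nlinarith
  obtain ⟨u, v, W', hu, hv, hsub, hbd⟩ := exists_subwalk_between
    (H := openGraph ω) (fun v => s * (z v).im - w.im) hs.le
    (fun u v huv => (abs_sub_le_of_openGraph_adj hz hω hs w.im huv).2) W hb hx' hy'
  refine ⟨u, v, W', hu, hv, fun q hq => ?_⟩
  obtain ⟨h1, h2⟩ := hbd q hq
  obtain ⟨⟨h3, h4⟩, -⟩ := hW q (hsub q hq)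
  have h5 := ere q
  refine ⟨⟨?_, ?_⟩, by linarith, by linarith⟩
  · nlinarith
  · nlinarith

/-- Monotonicity of `μ.real` along an inclusion valid on the carrier `{ω ⊆ E}` of `μ`.
[folklore] -/
private theorem measureReal_mono_of_subset_on {μ : Measure (BondConfig V)} [IsFiniteMeasure μ]
    {E : Set (Sym2 V)} (hμ : ∀ᵐ ω ∂μ, ω ⊆ E) {A B : Set (BondConfig V)}
    (h : ∀ ω, ω ⊆ E → ω ∈ A → ω ∈ B) : μ.real A ≤ μ.real B := by
  refine ENNReal.toReal_mono (measure_ne_top μ B) (measure_mono_ae ?_)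
  filter_upwards [hμ] with ω hω using h ω hω
set_option maxHeartbeats 400000 in
/-- **The rendered box-crossing property passes between homothetic drawings.** Let `μ` be a
finite measure on bond configurations carried by `{ω ⊆ E(G)}` and let `z` draw `G` with edges of
length `≤ 1`. If `μ` has the box-crossing property `HasBoxCrossingProperty` in the drawing
`t • z` for one `t ∈ (0, 2]`, then it has it in every drawing `s • z`, `s ∈ (0, 2]`. For the
aspect ratio `ρ` at scale `n` of `s • z` one reads: the lower bounds off the boxes of aspect
ratio `2ρ` at scale `⌊(t/s) n⌋₊` of `t • z`, and the upper bounds off the boxes of aspect ratio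
`ρ/2` at scale `⌈(t/s) n⌉₊` (`embRectCrossing_smul_of_smul`, `embTBCrossing_smul_of_smul` in
both directions), uniformly in the translation `w ↦ (t/s) w`. This is the formalisation-internal
content of "the box-crossing property is invariant under affine maps of `ℝ²`" (GM2013 §1.3, for
homotheties) in the tree's rendering, whose slack `2` limits it to drawings with edges of length
`≤ 2`. [cite: GrimmettManolescuAOP2013, §1.3 (Definition of the box-crossing property; "invariant under affine maps") with §3.1 Proposition (RSW) and Remark (arXiv:1105.5535 flat numbering: Def. 2, Prop. 12, Remark 13)] -/
theorem _root_.Literature.Probability.LatticeModels.HasBoxCrossingProperty.smul_of_smul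
    {μ : Measure (BondConfig V)} [IsFiniteMeasure μ] (hμ : ∀ᵐ ω ∂μ, ω ⊆ G.edgeSet)
    {z : V → ℂ} (hz : ∀ ⦃u v : V⦄, G.Adj u v → ‖z u - z v‖ ≤ 1) {s t : ℝ}
    (hs : 0 < s) (hs2 : s ≤ 2) (ht : 0 < t) (ht2 : t ≤ 2)
    (h : HasBoxCrossingProperty μ (fun v => (t : ℂ) * z v)) :
    HasBoxCrossingProperty μ (fun v => (s : ℂ) * z v) := by
  intro ρ hρ
  obtain ⟨c₁, hc₁, n₁, h₁⟩ := h (2 * ρ) (by positivity)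
  obtain ⟨c₂, hc₂, n₂, h₂⟩ := h (ρ / 2) (by positivity)
  refine ⟨min c₁ c₂, lt_min hc₁ hc₂, ⌈s / t * (n₁ + n₂ + 2)⌉₊, fun n hn w => ?_⟩
  have hst : 0 < s / t := div_pos hs ht
  have hts : 0 < t / s := div_pos ht hs
  -- the source scales
  set ξ : ℝ := t / s * n with hξ
  have hn' : s / t * (n₁ + n₂ + 2) ≤ n := (Nat.le_ceil _).trans (by exact_mod_cast hn)
  have hξ_ge : (n₁ : ℝ) + n₂ + 2 ≤ ξ := by
    have : t / s * (s / t * (n₁ + n₂ + 2)) ≤ t / s * n := mul_le_mul_of_nonneg_left hn' hts.le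
    have e : t / s * (s / t * ((n₁ : ℝ) + n₂ + 2)) = n₁ + n₂ + 2 := by
      field_simp
    linarith
  have hξ0 : 0 ≤ ξ := by positivity
  have hsξ : s * ξ = t * n := by
    rw [hξ]; field_simp
  set m : ℕ := ⌊ξ⌋₊ with hm
  set M : ℕ := ⌈ξ⌉₊ with hM
  have hm_le : (m : ℝ) ≤ ξ := Nat.floor_le hξ0
  have hm_gt : ξ < m + 1 := Nat.lt_floor_add_one ξ
  have hM_ge : ξ ≤ M := Nat.le_ceil ξ
  have hM_lt : (M : ℝ) < ξ + 1 := Nat.ceil_lt_add_one hξ0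
  have hn₁m : n₁ ≤ m := by
    have : (n₁ : ℝ) ≤ m := by linarith
    exact_mod_cast this
  have hn₂M : n₂ ≤ M := by
    have : (n₂ : ℝ) ≤ M := by linarith
    exact_mod_cast this
  -- the four comparisons of boxes
  have C1 : s * (m : ℝ) ≤ t * n := by nlinarith
  have C2 : t * (n : ℝ) ≤ 2 * (s * m) := by nlinarith
  have C3 : t * (n : ℝ) ≤ s * M := by nlinarith
  have C4 : s * (M : ℝ) ≤ 2 * (t * n) := by nlinarith
  -- the source translation
  set w' : ℂ := ((t / s : ℝ) : ℂ) * w with hw'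
  have hw : (s : ℂ) * w' = (t : ℂ) * w := by
    rw [hw', ← mul_assoc, ← Complex.ofReal_mul]
    congr 1
    have hs0 : (s : ℂ) ≠ 0 := by exact_mod_cast hs.ne'
    push_cast
    rw [mul_div_assoc', mul_div_cancel_left₀ _ hs0]
  have hw2 : (t : ℂ) * w = (s : ℂ) * w' := hw.symm
  obtain ⟨⟨hL1, -⟩, ⟨hL2, -⟩⟩ := h₁ m hn₁m w'
  obtain ⟨⟨-, hU1⟩, ⟨-, hU2⟩⟩ := h₂ M hn₂M w'
  have hρn : 0 ≤ ρ * n := by positivity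
  refine ⟨⟨?_, ?_⟩, ?_, ?_⟩
  · -- lower bound, horizontal: from the `2ρ m × m` box of `t • z`
    refine (min_le_left _ _).trans (hL1.trans (measureReal_mono_of_subset_on hμ fun ω hω hA => ?_))
    refine embRectCrossing_smul_of_smul hz hω hs hs2 ht hw hρn ?_ C1 hA
    nlinarith
  · -- upper bound, horizontal: into the `(ρ/2) M × M` box of `t • z`
    refine le_trans (measureReal_mono_of_subset_on hμ fun ω hω hA => ?_)
      (hU1.trans (by linarith [min_le_right c₁ c₂]))
    refine embRectCrossing_smul_of_smul hz hω ht ht2 hs hw2 (by positivity) ?_ C3 hA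
    nlinarith
  · -- lower bound, vertical: from the `m × 2ρ m` box of `t • z`
    refine (min_le_left _ _).trans (hL2.trans (measureReal_mono_of_subset_on hμ fun ω hω hA => ?_))
    refine embTBCrossing_smul_of_smul hz hω hs hs2 ht hw hρn ?_ C1 hA
    nlinarith
  · -- upper bound, vertical: into the `M × (ρ/2) M` box of `t • z`
    refine le_trans (measureReal_mono_of_subset_on hμ fun ω hω hA => ?_)
      (hU2.trans (by linarith [min_le_right c₁ c₂]))
    refine embTBCrossing_smul_of_smul hz hω ht ht2 hs hw2 (by positivity) ?_ C3 hA
    nlinarith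

end ScaleTransfer

/-! ### Consequences for the fact -/

/-- **The fact holds as soon as one drawing `t • triEmbed`, `0 < t ≤ 2`, has the box-crossing
property** (the edges of `triEmbed` have length `1`, `norm_triEmbed_eq_one_of_adj`, and
`P_{p_c}` is carried by `{ω ⊆ E(𝕋)}`; `HasBoxCrossingProperty.smul_of_smul`). In particular the
quantifier `∀ s ∈ (0, 2]` in `GrimmettManolescuAOP2013_triangular_boxCrossing` carries no
mathematical content beyond a single scale, in accordance with the scale-free printed notion
(GM2013 §1.3). [cite: GrimmettManolescuAOP2013, §1.3 (box-crossing property; invariance under affine maps)] -/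
theorem GrimmettManolescuAOP2013_triangular_boxCrossing_of_scale {t : ℝ} (ht : 0 < t)
    (ht2 : t ≤ 2)
    (h : HasBoxCrossingProperty (bondPercolation triGraph (criticalWeightI (Real.pi / 6)))
      (fun x : Site 2 => (t : ℂ) * triEmbed x)) :
    GrimmettManolescuAOP2013_triangular_boxCrossing := fun _s hs hs2 =>
  h.smul_of_smul (G := triGraph) ProbabilityTheory.setBernoulli_ae_subset
    (fun _u _v huv => (norm_triEmbed_eq_one_of_adj huv).le) hs hs2 ht ht2

/-- **The fact is equivalent to the body of the route item it grounds**
(`Summit.CriticalPhenomena.CardyFormulaZ2.Theses.CardyBondTriangular.BondTriangularBoxCrossing`: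
the drawing `√3 · (triEmbed x − (1 + ζ)/3)`, edge length `√3 ≤ 2`): forwards by
`…route_normalisation`, backwards by translating (`HasBoxCrossingProperty.sub_const`) and
`…_of_scale`. [cite: GrimmettManolescuAOP2013, §1.3 (box-crossing property; invariance under affine maps)] -/
theorem GrimmettManolescuAOP2013_triangular_boxCrossing_iff_route_normalisation :
    GrimmettManolescuAOP2013_triangular_boxCrossing ↔
      HasBoxCrossingProperty (bondPercolation triGraph (criticalWeightI (Real.pi / 6)))
        (fun x : Site 2 => (Real.sqrt 3 : ℂ) * (triEmbed x - (1 + triZeta) / 3)) := by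
  refine ⟨fun h => h.route_normalisation, fun h => ?_⟩
  have h3 : (0 : ℝ) < Real.sqrt 3 := Real.sqrt_pos.mpr (by norm_num)
  have h32 : Real.sqrt 3 ≤ 2 := by
    rw [show (2 : ℝ) = Real.sqrt (2 ^ 2) by rw [Real.sqrt_sq (by norm_num)]]
    exact Real.sqrt_le_sqrt (by norm_num)
  have h' := h.sub_const (-((Real.sqrt 3 : ℂ) * ((1 + triZeta) / 3)))
  refine GrimmettManolescuAOP2013_triangular_boxCrossing_of_scale h3 h32 ?_
  convert h' using 2 with x
  ring

/-- **The fact from the conclusion of Grimmett–Manolescu's isoradial theorem for `𝕋`.** Let `emb`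
be any rhombic embedding of `triGraph` whose drawing is a homothetic translate `t • triEmbed − w₀`
of the equilateral one with `0 < t ≤ 2` (the isoradial drawing, of unit circumradius, has
`t = √3`) and whose canonical measure `P_G` is `bondPercolation triGraph (criticalWeightI (π/6))`
(all half-angles `π/6`). If `P_G` has the box-crossing property in the drawing `emb.z` — the
conclusion of the tree fact `gm_boxCrossing triGraph emb ε` (GM, PTRF 159 (2014), Thm 1.1(a) =
§3 Thm 3.1, for `𝕋 ∈ 𝒢`: isoradial, rhombic tiling, BAP(`π/6`), square-grid property), or of
`gm_boxCrossingBounds_uniform` specialised to `𝕋` — then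
`GrimmettManolescuAOP2013_triangular_boxCrossing` holds. This records precisely what separates the
fact from the catalogued isoradial theorem: a triangular member of `𝒢` with these two fields.
[cite: GrimmettManolescuAOP2013, §1.3 Thm 3(b) (homogeneous case), a special case of GrimmettManolescu2014Isoradial §3 Thm 3.1] -/
theorem GrimmettManolescuAOP2013_triangular_boxCrossing_of_isoradialEmbedding {F : Type*}
    (emb : RhombicEmbedding triGraph F) {t : ℝ} (ht : 0 < t) (ht2 : t ≤ 2) (w₀ : ℂ)
    (hz : ∀ x, emb.z x = (t : ℂ) * triEmbed x - w₀)
    (hP : emb.isoradialPercolation = bondPercolation triGraph (criticalWeightI (Real.pi / 6)))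
    (h : HasBoxCrossingProperty emb.isoradialPercolation emb.z) :
    GrimmettManolescuAOP2013_triangular_boxCrossing := by
  have hz' : emb.z = fun x => (t : ℂ) * triEmbed x - w₀ := funext hz
  rw [hP, hz'] at h
  have h' := h.sub_const (-w₀)
  refine GrimmettManolescuAOP2013_triangular_boxCrossing_of_scale ht ht2 ?_
  convert h' using 2 with x
  ring

/-- `𝕋` is connected (it contains the connected spanning subgraph `ℤ²`, `zdGraph_le_triGraph`,
`zdGraph_preconnected`). (Grimmett 1999, §1.6.) [folklore] -/
theorem triGraph_preconnected : triGraph.Preconnected :=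
  zdGraph_preconnected_holds.mono zdGraph_le_triGraph

/-- **The fact from the tree fact `gm_boxCrossing` for a triangular member of `𝒢`.** If `emb` is
a rhombic embedding of `𝕋 = triGraph` drawn as `t • triEmbed − w₀` with `0 < t ≤ 2`, with
canonical measure `bondPercolation triGraph (criticalWeightI (π/6))`, which is isoradial, a
rhombic tiling, has BAP(`ε`) for some `ε > 0` and the printed square-grid property
`HasSquareGridPropertyGM` — i.e. `𝕋 ∈ 𝒢` in the sense of Grimmett–Manolescu 2014 — then
`gm_boxCrossing triGraph emb ε` (GM, PTRF 159 (2014), Thm 1.1(a) = §3 Thm 3.1: "For `G ∈ 𝒢`,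
`P_G` possesses the box-crossing property") yields
`GrimmettManolescuAOP2013_triangular_boxCrossing` (`𝕋` is connected, `triGraph_preconnected`).
The isoradial drawing of unit circumradius has `t = √3`, `w₀ = √3 (1 + ζ)/3`. This is the
dependency recorded by route `CardyBondTriangular` of `CriticalPhenomena/CardyFormulaZ2` for its
item `BondTriangularBoxCrossing` ("NEEDS-FACT `gm_boxCrossing` through `TriIsoradialInstance`").
[cite: GrimmettManolescu2014Isoradial, §3 Thm 3.1 (𝒢 ∋ 𝕋, §1); GrimmettManolescuAOP2013 §1.3 Thm 3(b) homogeneous case] -/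
theorem GrimmettManolescuAOP2013_triangular_boxCrossing_of_gm_boxCrossing {F : Type*}
    [DecidableEq F] (emb : RhombicEmbedding triGraph F) {ε t : ℝ} (ht : 0 < t) (ht2 : t ≤ 2)
    (w₀ : ℂ) (hz : ∀ x, emb.z x = (t : ℂ) * triEmbed x - w₀)
    (hP : emb.isoradialPercolation = bondPercolation triGraph (criticalWeightI (Real.pi / 6)))
    (hiso : emb.IsIsoradial) (hrh : emb.IsRhombicTiling) (hε : 0 < ε)
    (hbap : emb.HasBoundedAngles ε) (hsgp : emb.HasSquareGridPropertyGM)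
    (h : gm_boxCrossing triGraph emb ε) :
    GrimmettManolescuAOP2013_triangular_boxCrossing :=
  GrimmettManolescuAOP2013_triangular_boxCrossing_of_isoradialEmbedding emb ht ht2 w₀ hz hP
    (h triGraph_preconnected hiso hrh hε hbap hsgp)

end Literature.Probability.Percolation

end
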